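import Literature.Analysis.FluidPDE.WaveKinetic
import Literature.Analysis.FunctionSpaces.TorusLerayHelmholtzProofs
import Mathlib.MeasureTheory.Integral.Lebesgue.Markov
import HarnessLib

/-!
# Initial mode energies of Deng–Hani's random data
(discharge of the named fact `Literature.Analysis.FluidPDE.WaveKinetic.modeEnergy_randomData_zero`)

Companion ("Proofs") file of `Literature.Analysis.FluidPDE.WaveKinetic` (the third one, after
`WaveKineticProofs` and `WaveKineticEnergyProofs`), proving
`WaveKinetic.modeEnergy_randomData_zero_holds`: for a random phase family `η = (η_k)_{k ∈ ℤ^d}`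
under a probability measure `P` (`WaveKinetic.IsRandomPhaseFamily`: measurable, independent,
rotation invariant, `𝔼 |η_k|² = 1`), a nonnegative initial spectrum `n_in` with
`∑_k √(n_in(k/L)) < ∞`, and any random field `u` with `u(ω, 0) = WaveKinetic.randomData L n_in η ω
= ∑_k √(n_in(k/L)) η_k(ω) e_k`, the mode energies at time `0` are
`𝔼 |û(0, k)|² = n_in(k/L)` (Deng–Hani, Forum Math. Pi 9 (2021) e6, §1.1, (1.2):
`û_in(k) = √(n_in(k)) η_k(ω)` with `𝔼 |η_k|² = 1`, whence `𝔼 |û_in(k)|² = n_in(k)`, the `t = 0`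
case of the expansion in their Thm. 1.1).

## Proof

Write `c_k = √(n_in(k/L)) ≥ 0`, so `∑_k c_k < ∞`.

* `WaveKinetic.lintegral_enorm_le_two`: `𝔼 |η_k| ≤ 2`, from `|z| ≤ 1 + |z|²` and `𝔼 |η_k|² = 1`
  (the Bochner integral being `1 ≠ 0`, the integrand is integrable, so the Lebesgue integral is
  also `1`).
* `WaveKinetic.IsRandomPhaseFamily.ae_summable_norm_mul`: `∑_k c_k |η_k(ω)| < ∞` for `P`-a.e. `ω`
  (Tonelli for series, `MeasureTheory.lintegral_tsum`, and `𝔼 ∑_k c_k |η_k| ≤ 2 ∑_k c_k < ∞`).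
* `WaveKinetic.mFourierCoeff_randomData`: for such `ω` the random Fourier series converges
  absolutely and uniformly, and its `k`-th Fourier coefficient is `c_k η_k(ω)` (termwise
  integration against `e_{-k}` and orthonormality of the characters: the tree's
  `Torus.mFourierCoeff_tsum_mFourier_smul`).
* Hence `𝔼 |û(0, k)|² = ∫ c_k² |η_k|² dP = c_k² 𝔼 |η_k|² = c_k² = n_in(k/L)`
  (`MeasureTheory.integral_congr_ae`, `n_in ≥ 0`).

The statement was found faithful as vendored (not mis-stated); independence and rotation
invariance of the family are not used.

## References

* Y. Deng, Z. Hani, *On the derivation of the wave kinetic equation for NLS*, Forum Math. Pi 9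
  (2021), e6, §1.1, eq. (1.2) and Thm. 1.1. [DengHani2021]
* L. Grafakos, *Classical Fourier Analysis*, 3rd ed., GTM 249 (Springer 2014), Prop. 3.2.7 (1)
  (coefficients of absolutely convergent Fourier series). [Grafakos2014]
-/

open MeasureTheory ProbabilityTheory
open scoped ENNReal NNReal

namespace Literature.Analysis.FluidPDE

noncomputable section

namespace WaveKinetic

variable {d : Type*} [Fintype d]
variable {Ω : Type*} [MeasurableSpace Ω]

/-- **First absolute moment of a normalised random variable**: if `𝔼 |ξ|² = 1` (Bochner integral
under a probability measure) then `∫⁻ |ξ| dP ≤ 2` (from `|z| ≤ 1 + |z|²`; the sharp bound `1` by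
Cauchy–Schwarz is not needed). [folklore] -/
theorem lintegral_enorm_le_two {P : Measure Ω} [IsProbabilityMeasure P]
    {ξ : Ω → ℂ} (hξ : ∫ ω, ‖ξ ω‖ ^ 2 ∂P = 1) : ∫⁻ ω, ‖ξ ω‖ₑ ∂P ≤ 2 := by
  -- `x ≤ 1 + x²` in `ℝ≥0∞` (also `ENNReal.le_one_add_sq` in `FluidPDE/CylinderPairings`, not
  -- imported here to keep this file's dependencies small)
  have hle : ∀ x : ℝ≥0∞, x ≤ 1 + x ^ 2 := fun x => by
    rcases le_total x 1 with h | h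
    · exact h.trans le_self_add
    · calc x = x * 1 := (mul_one x).symm
        _ ≤ x * x := by gcongr
        _ = x ^ 2 := (sq x).symm
        _ ≤ 1 + x ^ 2 := le_add_self
  have hint : Integrable (fun ω => ‖ξ ω‖ ^ 2) P :=
    Integrable.of_integral_ne_zero (by rw [hξ]; exact one_ne_zero)
  have h2 : ∫⁻ ω, ‖ξ ω‖ₑ ^ 2 ∂P = 1 := by
    have h := ofReal_integral_eq_lintegral_ofReal hint (ae_of_all _ fun ω => sq_nonneg ‖ξ ω‖)
    rw [hξ, ENNReal.ofReal_one] at h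
    rw [h]
    refine lintegral_congr fun ω => ?_
    rw [← ofReal_norm, ENNReal.ofReal_pow (norm_nonneg _)]
  calc ∫⁻ ω, ‖ξ ω‖ₑ ∂P ≤ ∫⁻ ω, 1 + ‖ξ ω‖ₑ ^ 2 ∂P :=
        lintegral_mono fun ω => hle _
    _ = ∫⁻ _ω, 1 ∂P + ∫⁻ ω, ‖ξ ω‖ₑ ^ 2 ∂P := lintegral_add_left measurable_const _
    _ = 2 := by rw [lintegral_const, measure_univ, mul_one, h2, one_add_one_eq_two]

/-- **Almost sure absolute convergence of the random Fourier coefficients**: for a random phase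
family `η` (only measurability and `𝔼 |η_k|² = 1` are used) and nonnegative summable weights
`c`, `∑_k c_k |η_k(ω)| < ∞` for `P`-a.e. `ω` (Tonelli for series and `𝔼 |η_k| ≤ 2`). This is the
"a.s. absolutely summable" remark in the docstring of `WaveKinetic.randomData`. [folklore] -/
theorem IsRandomPhaseFamily.ae_summable_norm_mul {P : Measure Ω} [IsProbabilityMeasure P]
    {η : (d → ℤ) → Ω → ℂ} (hη : IsRandomPhaseFamily P η) {c : (d → ℤ) → ℝ} (hc0 : ∀ l, 0 ≤ c l)
    (hc : Summable c) : ∀ᵐ ω ∂P, Summable fun l => ‖(c l : ℂ) * η l ω‖ := by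
  have hmeas : ∀ l, AEMeasurable (fun ω => ‖(c l : ℂ) * η l ω‖ₑ) P := fun l =>
    (measurable_const.mul (hη.1 l)).enorm.aemeasurable
  have hb : ∀ l, ∫⁻ ω, ‖(c l : ℂ) * η l ω‖ₑ ∂P ≤ ENNReal.ofReal (c l) * 2 := fun l => by
    calc ∫⁻ ω, ‖(c l : ℂ) * η l ω‖ₑ ∂P = ∫⁻ ω, ENNReal.ofReal (c l) * ‖η l ω‖ₑ ∂P := by
          refine lintegral_congr fun ω => ?_
          rw [enorm_mul, ← ofReal_norm (c l : ℂ), Complex.norm_of_nonneg (hc0 l)]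
      _ = ENNReal.ofReal (c l) * ∫⁻ ω, ‖η l ω‖ₑ ∂P := lintegral_const_mul _ (hη.1 l).enorm
      _ ≤ ENNReal.ofReal (c l) * 2 := by
          gcongr
          exact lintegral_enorm_le_two (hη.2.2 l).2
  have hfin : ∑' l, ∫⁻ ω, ‖(c l : ℂ) * η l ω‖ₑ ∂P ≠ ∞ := by
    refine ne_top_of_le_ne_top ?_ (ENNReal.tsum_le_tsum hb)
    rw [ENNReal.tsum_mul_right, ← ENNReal.ofReal_tsum_of_nonneg hc0 hc]
    exact ENNReal.mul_ne_top ENNReal.ofReal_ne_top ENNReal.ofNat_ne_top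
  rw [← lintegral_tsum hmeas] at hfin
  refine (ae_lt_top' (AEMeasurable.tsum hmeas) hfin).mono fun ω hω => ?_
  have h := (ENNReal.tsum_coe_ne_top_iff_summable_coe
    (f := fun l => ‖(c l : ℂ) * η l ω‖₊)).mp hω.ne
  simpa only [coe_nnnorm] using h

variable [DecidableEq d]

omit [MeasurableSpace Ω] in
/-- **Fourier coefficients of the random data**: if `∑_l √(n_in(l/L)) |η_l(ω)| < ∞` then the
random Fourier series `randomData L n_in η ω = ∑_l √(n_in(l/L)) η_l(ω) e_l` converges absolutely
and uniformly on `T^d` and `𝓕(randomData L n_in η ω)(k) = √(n_in(k/L)) η_k(ω)` (Deng–Hani 2021,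
(1.2): `û_in(k) = √(n_in(k)) η_k(ω)`; termwise integration and orthonormality of the characters,
the tree's `Torus.mFourierCoeff_tsum_mFourier_smul`). [cite: DengHani2021, §1.1 (1.2)] -/
theorem mFourierCoeff_randomData {L : ℝ} {nin : EuclideanSpace ℝ d → ℝ}
    {η : (d → ℤ) → Ω → ℂ} {ω : Ω}
    (hω : Summable fun l =>
      ‖(Real.sqrt (nin (L⁻¹ • FunctionSpaces.Torus.latticeVec l)) : ℂ) * η l ω‖)
    (k : d → ℤ) :
    UnitAddTorus.mFourierCoeff (randomData L nin η ω) k =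
      (Real.sqrt (nin (L⁻¹ • FunctionSpaces.Torus.latticeVec k)) : ℂ) * η k ω := by
  have h : randomData L nin η ω = fun x => ∑' l, UnitAddTorus.mFourier l x •
      ((Real.sqrt (nin (L⁻¹ • FunctionSpaces.Torus.latticeVec l)) : ℂ) * η l ω) := by
    funext x
    unfold randomData
    exact tsum_congr fun l => by rw [smul_eq_mul]; ring
  rw [h]
  exact FunctionSpaces.Torus.mFourierCoeff_tsum_mFourier_smul hω k

/-- **Initial mode energies of the random data** (discharge of
`WaveKinetic.modeEnergy_randomData_zero`): for a random phase family `η` under the probability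
measure `P`, `n_in ≥ 0` with `∑_k √(n_in(k/L)) < ∞` and `u(ω, 0) = randomData L n_in η ω`, one has
`𝔼 |û(0, k)|² = n_in(k/L)` for every `k ∈ ℤ^d`: a.e. the Fourier coefficient is
`√(n_in(k/L)) η_k(ω)` (`mFourierCoeff_randomData`, on the full-measure set of
`IsRandomPhaseFamily.ae_summable_norm_mul`), and `𝔼 |η_k|² = 1`
(Deng–Hani 2021, §1.1, (1.2) and the `t = 0` case of Thm. 1.1). [cite: DengHani2021, §1.1 (1.2)] -/
theorem modeEnergy_randomData_zero_holds : modeEnergy_randomData_zero (d := d) (Ω := Ω) := by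
  intro P _ η hη L nin hnonneg hsum u hu k
  have hc0 : ∀ l, 0 ≤ Real.sqrt (nin (L⁻¹ • FunctionSpaces.Torus.latticeVec l)) := fun l =>
    Real.sqrt_nonneg _
  have hae := hη.ae_summable_norm_mul hc0 hsum
  unfold modeEnergy
  calc ∫ ω, ‖UnitAddTorus.mFourierCoeff (u ω 0) k‖ ^ 2 ∂P
      = ∫ ω, Real.sqrt (nin (L⁻¹ • FunctionSpaces.Torus.latticeVec k)) ^ 2 * ‖η k ω‖ ^ 2 ∂P := by
        refine integral_congr_ae (hae.mono fun ω hω => ?_)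
        simp only
        rw [hu ω, mFourierCoeff_randomData hω k, norm_mul, Complex.norm_of_nonneg (hc0 k), mul_pow]
    _ = Real.sqrt (nin (L⁻¹ • FunctionSpaces.Torus.latticeVec k)) ^ 2 * ∫ ω, ‖η k ω‖ ^ 2 ∂P :=
        integral_const_mul _ _
    _ = nin (L⁻¹ • FunctionSpaces.Torus.latticeVec k) := by
        rw [(hη.2.2 k).2, mul_one, Real.sq_sqrt (hnonneg _)]

end WaveKinetic

end

end Literature.Analysis.FluidPDE
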